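import Summits.QuantumFields.YangMills.Theorems.BalabanLadderUVSeamRecCarrierExpMomentsDefs
import Summits.QuantumFields.YangMills.Theorems.BalabanLadderUVSeamRecCarrierExpMomentFixedScale
import Summits.QuantumFields.YangMills.Theorems.BalabanLadderUVSeamRecColdWallDirichletRateOfSplit
import Summits.QuantumFields.YangMills.Theorems.BalabanLadderUVSeamRecClassicalResponseTempering
import HarnessLib

/-!
# Crux `UVSeamRec` (stmt-QuantumFields-20043), line `coldwall_pure`: GLUE for the binder (EM_Q) «carrier exponential moments» —
# `GaussianDominationSU2 ⇒ CarrierExpMomentsSU2`, and `CarrierExpMomentsSU2` does everything the line asks of (GD)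

Helper file (`--supports stmt-QuantumFields-20043`) of the LEAD seat `ym-spine-20043-p1` (gen 17); sequel of `…CarrierExpMomentsDefs`
(the named `Prop`s `CarrierExpMoments C B β₁ ℓ₁`, `CarrierExpMomentsSU2`).  Registered skeleton RESHAPE 2 (sha `c86db84aa426ab4c`) consumes
`stub_gaussianDomination : GaussianDominationSU2` twice: in `stub_dirichletRate` (`dirichletRateSU2_of_coldWallSplit_of_gaussianDomination`, p635304 —
through the carrier MEAN) and in `stub_responseMomentsOdd6` (`responseMomentsOdd6SU2_of_pureSplitCl_and_gaussianDomination` — through (EM_Q)).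
This file proves that the weaker binder suffices for both, and that (GD) implies it:

* §1 `carrierExpMoments_mono` / `carrierExpMoments_weaken` — a larger carrier constant `C`, a larger threshold or a smaller physical size is weaker;
* §2 `carrierExpMomentsSU2_of_gaussianDomination` — (GD) ⇒ (EM_Q^∃), by the tree's Hubbard–Stratonovich press `emQ_of_subGaussianLinear`
  (p545723) after rescaling the carrier constant to `C = max 1 (4v₁+1)` (`emLin_rescale`);
* §3 `responseMomentsOdd6SU2_of_backgroundField_and_carrierExpMoments`, `responseMomentsOdd6SU2_of_pureSplitCl_and_carrierExpMoments` —
  (BF)/(split) ∧ (EM_Q^∃) ⇒ the registered (RM) body, by the (RM) press `responseMoments_of_quadratic_and_influence` (p541348) at the common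
  constant `max C_s C`;
* §4 `torusE_carrierCl_le_of_carrierExpMoments` (the carrier MEAN `⟨carrierCl 1 1⟩ ≤ C·B/2` by Jensen, `torusE_le_log_torusE_exp`),
  `dirichletRateSU2_of_coldWallSplit_of_carrierExpMoments` ((CW) ∧ (EM_Q^∃) ⇒ (DR), via LEAD g16's `dirichletRate_of_coldWallSplit_of_carrierMean`),
  `pureSplitClSU2_of_dirichletRateSU2_of_coldWallSplit` (the skeleton's `pureSplitClSU2_of_stubs`, importable) and
  `responseMomentsOdd6SU2_of_coldWallSplit_of_carrierExpMoments` ((CW) ∧ (EM_Q^∃) ⇒ (RM)).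

CONSEQUENCE (planner's / OWNER's pen, NOT executed here): a reshape `stub_gaussianDomination ↦ stub_carrierExpMoments : CarrierExpMomentsSU2` keeps the
composition `UVSeamRec_of` closed (`stub_dirichletRate := dirichletRateSU2_of_coldWallSplit_of_carrierExpMoments stub_coldWallSplit stub_carrierExpMoments`,
`stub_responseMomentsOdd6 := fun _ => responseMomentsOdd6SU2_of_coldWallSplit_of_carrierExpMoments stub_coldWallSplit stub_carrierExpMoments`), and the
FIXED-SCALE RUNG `torusE_exp_two_mul_sum_carrierCl_le_fixedScale` (p641905) is then literally the new stub's sentence at each fixed `R`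
(`C_R = 24R⁴`, `B_R = 6(2R+4)⁴(81 + 6 log β/(2L+1))`).

HONEST FRAMING: plumbing between named conditional binders; (EM_Q^∃) uniform in `R` is OPEN (E0′-type); nothing of E0′, NT or the gap is proved;
YM mass gap NOT proved; not Clay.
-/

noncomputable section

open MeasureTheory Filter Topology Finset
open Literature.MathematicalPhysics.QuantumFieldTheory (GaugeConfig LatticeRep)
open Literature.MathematicalPhysics.QuantumLattice (fundamentalRep fundamentalLatticeRep LGConfig)
open Summit.QuantumFields.YangMills.Cruxes.OSLegsFromFemtoAndGap.DlrCollarTransfer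
open Summit.QuantumFields.YangMills.Cruxes.UVSeamRec
open Summit.QuantumFields.YangMills.Cruxes.UVSeamRec.ResponsePinning (torusE_mono torusE_const_mul' torusE_const abs_torusE_sub_le_of_forall)
open Summit.QuantumFields.YangMills.Cruxes.UVSeamRec.ResponseMomentsDefs (ResponseMomentsOdd6SU2)
open Summit.QuantumFields.YangMills.Cruxes.UVSeamRec.PolymerData
open Summit.QuantumFields.YangMills.Cruxes.UVSeamRec.TemperedResponse

namespace Summit.QuantumFields.YangMills.Cruxes.UVSeamRec.ClassicalResponse

/-! ### §1 Monotonicity of the binder -/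

/-- **A larger carrier constant is weaker**: for `0 < C ≤ C'` and `β₁ ≥ 0`, `CarrierExpMoments C B β₁ ℓ₁ → CarrierExpMoments C' B β₁ ℓ₁`
(the carrier is `∝ 1/C` and non-negative for `β ≥ 0`). [folklore] -/
theorem carrierExpMoments_mono {C C' B β₁ ℓ₁ : ℝ} (hC : 0 < C) (hCC' : C ≤ C') (hβ₁ : 0 ≤ β₁)
    (h : CarrierExpMoments C B β₁ ℓ₁) : CarrierExpMoments C' B β₁ ℓ₁ := by
  intro β hβ L n q x R hq hR hRu hRL hsep T
  set rF : LatticeRep (Matrix.specialUnitaryGroup (Fin 2) ℂ) := fundamentalLatticeRep 2 with hrF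
  have hβ0 : 0 ≤ β := hβ₁.trans hβ
  have hC' : 0 < C' := hC.trans_le hCC'
  have hpt : ∀ U : LGConfig 4 (Matrix.specialUnitaryGroup (Fin 2) ℂ),
      Real.exp (((2 : ℕ) : ℝ) * ∑ i ∈ T, carrierCl rF C' 1 β R (q i) (x i) U) ≤
        Real.exp (((2 : ℕ) : ℝ) * ∑ i ∈ T, carrierCl rF C 1 β R (q i) (x i) U) := by
    intro U
    refine Real.exp_le_exp.2 (mul_le_mul_of_nonneg_left (sum_le_sum fun i _ => ?_) (by positivity))
    rw [carrierCl_eq_mul rF C C' 1 β hC.ne']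
    have hr : C / C' ≤ 1 := (div_le_one hC').2 hCC'
    exact mul_le_of_le_one_left (carrierCl_nonneg hC one_pos hβ0 R (q i) (x i) U) hr
  have hcont : ∀ D : ℝ, Continuous fun U : LGConfig 4 (Matrix.specialUnitaryGroup (Fin 2) ℂ) =>
      Real.exp (((2 : ℕ) : ℝ) * ∑ i ∈ T, carrierCl rF D 1 β R (q i) (x i) U) := fun D =>
    Real.continuous_exp.comp (continuous_const.mul (continuous_finsetSum _ fun i _ =>
      continuous_const.mul (continuous_classicalResponse (r := rF) _ _ (q i) (x i) 1)))
  exact (torusE_mono rF β L (hcont C') (hcont C) hpt).trans (h β hβ L n q x R hq hR hRu hRL hsep T)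

/-- **Weakening the guards**: a larger threshold and a smaller physical size are weaker. [folklore] -/
theorem carrierExpMoments_weaken {C B β₁ β₁' ℓ₁ ℓ₁' : ℝ} (hβ : β₁ ≤ β₁') (hℓ : ℓ₁' ≤ ℓ₁)
    (h : CarrierExpMoments C B β₁ ℓ₁) : CarrierExpMoments C B β₁' ℓ₁' :=
  fun β hβ' L n q x R hq hR hRu hRL hsep T => h β (hβ.trans hβ') L n q x R hq hR (hRu.trans hℓ) hRL hsep T

/-! ### §2 (GD) implies the binder -/

/-- **(GD) ⇒ (EM_Q^∃).**  From `EMLin 1 β₁ ℓ₁ m₁ v₁`: rescale the carrier constant to `C := max 1 (4v₁ + 1)` (`emLin_rescale`: `(m, v) ↦ (m₁/√C, v₁/C)`,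
so `4·1·v < 1`), then Hubbard–Stratonovich (`emQ_of_subGaussianLinear` with `λ = 1`, `ℓ = √carrierCl C 1`) on `β ≥ max β₁ 0`:
`CarrierExpMoments C B (max β₁ 0) ℓ₁` with `B = log(2(1−4v)^{−1/2} e^{2m²/(1−4v)})`. [folklore] -/
theorem carrierExpMomentsSU2_of_gaussianDomination (hGD : GaussianDominationSU2) : CarrierExpMomentsSU2 := by
  obtain ⟨m₁, v₁, β₁, ℓ₁, hℓ₁, hEM⟩ := hGD
  set C : ℝ := max 1 (4 * v₁ + 1) with hCdef
  have hCpos : 0 < C := lt_of_lt_of_le one_pos (le_max_left _ _)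
  have h4v : 4 * 1 * (v₁ / C) < 1 := by
    rw [mul_one, mul_div_assoc', div_lt_one hCpos]
    have : 4 * v₁ + 1 ≤ C := le_max_right _ _
    linarith
  set β₀ : ℝ := max β₁ 0 with hβ₀
  have hβ₀₁ : β₁ ≤ β₀ := le_max_left _ _
  have hβ₀0 : 0 ≤ β₀ := le_max_right _ _
  set rF : LatticeRep (Matrix.specialUnitaryGroup (Fin 2) ℂ) := fundamentalLatticeRep 2 with hrF
  have hEMC := emLin_rescale hCpos hEM
  set ℓ : ℝ → ℕ → Fin 4 × Fin 4 → (Fin 4 → ℤ) → LGConfig 4 (Matrix.specialUnitaryGroup (Fin 2) ℂ) → ℝ :=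
    fun β R q x η => Real.sqrt (carrierCl rF C 1 β R q x η) with hℓdef
  have hℓm : ∀ β R q x, Measurable (ℓ β R q x) := fun β R q x => (measurable_carrierCl (r := rF) C 1 β R q x).sqrt
  have hℓb : ∀ β R q x η, |ℓ β R q x η| ≤ Real.sqrt (|β| * (R : ℝ) ^ 4 / |C| * (2 * rF.N)) := fun β R q x η => by
    simp only [hℓdef]
    rw [abs_of_nonneg (Real.sqrt_nonneg _)]
    exact Real.sqrt_le_sqrt ((le_abs_self _).trans (abs_carrierCl_le (r := rF) C one_pos β R q x η))
  have hEMQ1 := emQ_of_subGaussianLinear rF Transport.uRec (β₁ := β₀) (ℓ₁ := ℓ₁) ℓ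
    (fun β R => Real.sqrt (|β| * (R : ℝ) ^ 4 / |C| * (2 * rF.N))) hℓm hℓb (m := m₁ / Real.sqrt C) (v := v₁ / C) (lam := 1)
    zero_le_one h4v
    (fun β hβ L n q x R hq hR hRa hL hsep T t => hEMC β (hβ₀₁.trans hβ) L n q x R hq hR hRa hL hsep T t)
  refine ⟨C, Real.log (2 * (Real.sqrt (1 / (1 - 4 * (1 * (v₁ / C)))) *
      Real.exp (2 * 1 * (m₁ / Real.sqrt C) ^ 2 / (1 - 4 * (1 * (v₁ / C)))))), β₀, ℓ₁, hCpos, hℓ₁, ?_⟩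
  intro β hβ L n q x R hq hR hRa hL hsep T
  have h := hEMQ1 β hβ L n q x R hq hR hRa hL hsep T
  have e : (fun U : LGConfig 4 (Matrix.specialUnitaryGroup (Fin 2) ℂ) =>
      Real.exp (((2 : ℕ) : ℝ) * ∑ i ∈ T, carrierCl rF C 1 β R (q i) (x i) U)) =
      (fun U => Real.exp (((2 : ℕ) : ℝ) * ∑ i ∈ T, 1 * (ℓ β R (q i) (x i) U) ^ 2)) := by
    funext U
    refine congrArg Real.exp (congrArg _ (Finset.sum_congr rfl fun i _ => ?_))
    simp only [hℓdef]
    rw [one_mul, Real.sq_sqrt (carrierCl_nonneg (r := rF) hCpos one_pos (hβ₀0.trans hβ) R (q i) (x i) U)]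
  rw [e]
  exact h

/-! ### §3 The binder feeds the (RM) press -/

/-- **(BF) ∧ (EM_Q^∃) ⇒ (RM)**: the v6(β-cl) glue `responseMomentsOdd6SU2_of_backgroundField_and_gaussianDomination` with its (EM_Q) input supplied
by the binder instead of by (GD): common constant `C' := max C_s C` (rescale (split-cl) up by `splitCl_rescale`, weaken (EM_Q) by `carrierExpMoments_mono`),
common guards `β ≥ max (max β₁ β₁') 0`, `R·uRec β ≤ min ℓ₁ ℓ₁'`, then the (RM) press `responseMoments_of_quadratic_and_influence` (p541348). [folklore] -/
theorem responseMomentsOdd6SU2_of_backgroundField_and_carrierExpMoments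
    (hBF : BackgroundFieldSU2) (hCE : CarrierExpMomentsSU2) : ResponseMomentsOdd6SU2 := by
  obtain ⟨𝔟, ε, kmax, C_s, C₁, A₀, P₀, β₁, ℓ₁, B_I, p, hCs, hC₁, hA₀, hℓ₁, hp, hsplit, hEMI⟩ := hBF
  obtain ⟨C, B, β₁', ℓ₁', hC, hℓ₁', hCE⟩ := hCE
  set C' : ℝ := max C_s C with hC'def
  have hCsC : C_s ≤ C' := le_max_left _ _
  have hCC : C ≤ C' := le_max_right _ _
  have hC'pos : 0 < C' := hCs.trans_le hCsC
  set β₀ : ℝ := max (max β₁ β₁') 0 with hβ₀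
  have hβ₀₁ : β₁ ≤ β₀ := (le_max_left _ _).trans (le_max_left _ _)
  have hβ₀₁' : β₁' ≤ β₀ := (le_max_right _ _).trans (le_max_left _ _)
  have hβ₀0 : 0 ≤ β₀ := le_max_right _ _
  set ℓ₀ : ℝ := min ℓ₁ ℓ₁' with hℓ₀
  have hℓ₀pos : 0 < ℓ₀ := lt_min hℓ₁ hℓ₁'
  set rF : LatticeRep (Matrix.specialUnitaryGroup (Fin 2) ℂ) := fundamentalLatticeRep 2 with hrF
  -- rescaled split, weakened (EM_Q)
  have hsplitC := splitCl_rescale hCs hCsC hA₀ hsplit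
  have hCE' : CarrierExpMoments C' B β₀ ℓ₀ :=
    carrierExpMoments_mono hC hCC hβ₀0 (carrierExpMoments_weaken hβ₀₁' (min_le_right _ _) hCE)
  -- (RM) body from p541348
  have hRM := responseMoments_of_quadratic_and_influence (N := 2) rF Transport.uRec
    (C₁ := C₁ * C' / C_s) (β₁ := β₀) (ℓ₁ := ℓ₀) (A₀ := A₀) (p := p)
    (fun β R q x η => carrierCl rF C' 1 β R q x η)
    (fun β R => |β| * (R : ℝ) ^ 4 / |C'| * (2 * rF.N))
    (fun β R q x => measurable_carrierCl (r := rF) C' 1 β R q x)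
    (fun β R q x η => abs_carrierCl_le (r := rF) C' one_pos β R q x η) 𝔟 ε kmax
    (fun β hβ R hR hRa q x hq η => hsplitC β (hβ₀₁.trans hβ) R hR (hRa.trans (min_le_left _ _)) q x hq η)
    (fun β hβ L n q x R hq hR hRa hL hsep T => hCE' β hβ L n q x R hq hR hRa hL hsep T)
    (fun β hβ L n q x R hq hR hRa hL hsep T =>
      hEMI β (hβ₀₁.trans hβ) L n q x R hq hR (hRa.trans (min_le_left _ _)) hL hsep T)
  exact ⟨Transport.uRec, 1, C₁ * C' / C_s, _, β₀, ℓ₀, P₀, p, one_pos,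
    Filter.Eventually.of_forall fun β => by rw [one_mul], hℓ₀pos, by positivity, hp, hRM⟩

/-- **(split) ∧ (EM_Q^∃) ⇒ (RM)** — the flag-free form (tempered-d1's `backgroundFieldSU2_of_pureSplitCl`). [folklore] -/
theorem responseMomentsOdd6SU2_of_pureSplitCl_and_carrierExpMoments (hS : PureSplitClSU2) (hCE : CarrierExpMomentsSU2) :
    ResponseMomentsOdd6SU2 :=
  responseMomentsOdd6SU2_of_backgroundField_and_carrierExpMoments (backgroundFieldSU2_of_pureSplitCl hS) hCE

/-! ### §4 The binder gives the carrier mean, hence (DR), the flag-free split and (RM) from (CW) -/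

/-- **The carrier MEAN from (EM_Q)** (Jensen): under `CarrierExpMoments C B β₁ ℓ₁` (`C > 0`), for `β ≥ β₁`, `β ≥ 0`, `1 ≤ R`, `R·uRec β ≤ ℓ₁`,
`4R+8 ≤ L`, `q.1 < q.2`: `⟨carrierCl 1 1 β R q x⟩_{2L+1,β} ≤ C·B/2` (the one-member family; `carrierCl 1 = C·carrierCl C`). [folklore] -/
theorem torusE_carrierCl_le_of_carrierExpMoments {C B β₁ ℓ₁ : ℝ} (hC : 0 < C) (h : CarrierExpMoments C B β₁ ℓ₁) {β : ℝ}
    (hβ : β₁ ≤ β) (hβ0 : 0 ≤ β) {L R : ℕ} (q : Fin 4 × Fin 4) (x : Fin 4 → ℤ) (hq : q.1 < q.2) (hR : 1 ≤ R)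
    (hRu : (R : ℝ) * Transport.uRec β ≤ ℓ₁) (hRL : 4 * R + 8 ≤ L) :
    torusE (Matrix.specialUnitaryGroup (Fin 2) ℂ) (fundamentalLatticeRep 2) β L
        (carrierCl (fundamentalLatticeRep 2) 1 1 β R q x) ≤ C * B / 2 := by
  set rF : LatticeRep (Matrix.specialUnitaryGroup (Fin 2) ℂ) := fundamentalLatticeRep 2 with hrF
  have h1 := h β hβ L 1 (fun _ => q) (fun _ => x) R (fun _ => hq) hR hRu hRL
    (fun i j hij => absurd (Subsingleton.elim i j) hij) Finset.univ
  simp only [univ_unique, sum_singleton, card_singleton, Nat.cast_one, mul_one] at h1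
  -- Jensen on `A := 2·carrierCl C`
  have hcQ : Continuous (carrierCl rF C 1 β R q x) := continuous_const.mul (continuous_classicalResponse (r := rF) _ _ q x 1)
  have hcA : Continuous fun U : LGConfig 4 (Matrix.specialUnitaryGroup (Fin 2) ℂ) => ((2 : ℕ) : ℝ) * carrierCl rF C 1 β R q x U :=
    continuous_const.mul hcQ
  have hpos : 0 < torusE (Matrix.specialUnitaryGroup (Fin 2) ℂ) rF β L
      (fun U => Real.exp (((2 : ℕ) : ℝ) * carrierCl rF C 1 β R q x U)) := by
    have h1le : torusE (Matrix.specialUnitaryGroup (Fin 2) ℂ) rF β L (fun _ => (1 : ℝ)) ≤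
        torusE (Matrix.specialUnitaryGroup (Fin 2) ℂ) rF β L (fun U => Real.exp (((2 : ℕ) : ℝ) * carrierCl rF C 1 β R q x U)) :=
      torusE_mono rF β L continuous_const (Real.continuous_exp.comp hcA) fun U =>
        Real.one_le_exp (mul_nonneg (by positivity) (carrierCl_nonneg hC one_pos hβ0 R q x U))
    rw [torusE_const] at h1le
    linarith
  have hJ : torusE (Matrix.specialUnitaryGroup (Fin 2) ℂ) rF β L (fun U => ((2 : ℕ) : ℝ) * carrierCl rF C 1 β R q x U) ≤ B := by
    refine (torusE_le_log_torusE_exp rF β L hcA).trans ?_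
    rw [Real.log_le_iff_le_exp hpos]
    exact h1
  rw [torusE_const_mul'] at hJ
  have h3 : carrierCl rF 1 1 β R q x = fun U => C * carrierCl rF C 1 β R q x U := by
    funext U
    rw [carrierCl_eq_mul rF C 1 1 β hC.ne', div_one]
  rw [h3, torusE_const_mul']
  push_cast at hJ
  nlinarith [hJ, hC]

/-- **(CW) ∧ (EM_Q^∃) ⇒ (DR)** — LEAD g16's `dirichletRate_of_coldWallSplit_of_carrierMean` with the carrier mean `C·B/2` of the binder (clipped at `0`) in place of
(GD)'s `2e^{m₁+v₁/2}`; reference values = plaquette means of one big torus per `β`. [folklore] -/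
theorem dirichletRateSU2_of_coldWallSplit_of_carrierExpMoments (hCW : (∃ (C_s C₁ A₂ β₂ ℓ₂ : ℝ), 0 < C_s ∧ 0 < C₁ ∧ 0 ≤ A₂ ∧ 0 < ℓ₂ ∧
      ∀ β : ℝ, β₂ ≤ β → ∀ R : ℕ, 1 ≤ R → (R : ℝ) * Transport.uRec β ≤ ℓ₂ →
      ∀ (q : Fin 4 × Fin 4) (x : Fin 4 → ℤ), q.1 < q.2 → ∀ η : LGConfig 4 (Matrix.specialUnitaryGroup (Fin 2) ℂ),
      (R : ℝ) ^ 4 / C₁ * |kerE (Matrix.specialUnitaryGroup (Fin 2) ℂ) (fundamentalLatticeRep 2) β (fun k => x k - (R + 1)) (2 * R + 3) η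
          (plane (Matrix.specialUnitaryGroup (Fin 2) ℂ) (fundamentalLatticeRep 2) q x) -
        kerE (Matrix.specialUnitaryGroup (Fin 2) ℂ) (fundamentalLatticeRep 2) β (fun k => x k - (R + 1)) (2 * R + 3) 1
          (plane (Matrix.specialUnitaryGroup (Fin 2) ℂ) (fundamentalLatticeRep 2) q x)| ≤
        A₂ + carrierCl (fundamentalLatticeRep 2) C_s 1 β R q x η)) (hCE : CarrierExpMomentsSU2) : DirichletRateSU2 := by
  obtain ⟨C_s, C₁, A₂, β₂, ℓ₂, hCs, hC₁, hA₂, hℓ₂, hCW⟩ := hCW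
  obtain ⟨C, B, β₁, ℓ₁, hC, hℓ₁, hCE⟩ := hCE
  obtain ⟨P₀, hP₀⟩ := exists_abs_plane_le (G := Matrix.specialUnitaryGroup (Fin 2) ℂ) (fundamentalLatticeRep 2)
  have hCM : ∀ β : ℝ, max β₁ 0 ≤ β → ∀ (L R : ℕ) (q : Fin 4 × Fin 4) (x : Fin 4 → ℤ), q.1 < q.2 → 1 ≤ R →
      (R : ℝ) * Transport.uRec β ≤ ℓ₁ → 4 * R + 8 ≤ L →
      torusE (Matrix.specialUnitaryGroup (Fin 2) ℂ) (fundamentalLatticeRep 2) β L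
        (carrierCl (fundamentalLatticeRep 2) 1 1 β R q x) ≤ max (C * B / 2) 0 :=
    fun β hβ L R q x hq hR hRu hRL =>
      (torusE_carrierCl_le_of_carrierExpMoments hC hCE ((le_max_left _ _).trans hβ) ((le_max_right _ _).trans hβ) q x hq hR hRu hRL).trans
        (le_max_left _ _)
  have hDR := dirichletRate_of_coldWallSplit_of_carrierMean hCs hC₁ hCW hCM
  have hp : ∀ (q : Fin 4 × Fin 4) (β : ℝ),
      |torusE (Matrix.specialUnitaryGroup (Fin 2) ℂ) (fundamentalLatticeRep 2) β (4 * ⌈min ℓ₂ ℓ₁ / Transport.uRec β⌉₊ + 8)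
        (plane (Matrix.specialUnitaryGroup (Fin 2) ℂ) (fundamentalLatticeRep 2) q 0)| ≤ P₀ := fun q β => by
    have h := abs_torusE_sub_le_of_forall (fundamentalLatticeRep 2) β
      (4 * ⌈min ℓ₂ ℓ₁ / Transport.uRec β⌉₊ + 8) (continuous_plane (fundamentalLatticeRep 2) q 0) (c := 0) (h := P₀)
      (fun U => by rw [sub_zero]; exact hP₀ q 0 U)
    rwa [sub_zero] at h
  exact ⟨C₁, A₂ + max (C * B / 2) 0 / C_s, P₀, max β₂ (max β₁ 0), min ℓ₂ ℓ₁, _, hC₁, by positivity,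
    lt_min hℓ₂ hℓ₁, hp, hDR⟩

/-- **(DR) ∧ (CW) ⇒ the flag-free split `PureSplitClSU2`** — the skeleton's `pureSplitClSU2_of_stubs` made importable: restrict to the common window,
rescale the cold-wall kernel constant `C₁'` to (DR)'s `C₁`, then LEAD g10's triangle `pureSplitCl_of_dirichletRate_and_coldWallSplit`. [folklore] -/
theorem pureSplitClSU2_of_dirichletRateSU2_of_coldWallSplit (hDR : DirichletRateSU2) (hCW : (∃ (C_s C₁ A₂ β₂ ℓ₂ : ℝ), 0 < C_s ∧ 0 < C₁ ∧ 0 ≤ A₂ ∧ 0 < ℓ₂ ∧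
      ∀ β : ℝ, β₂ ≤ β → ∀ R : ℕ, 1 ≤ R → (R : ℝ) * Transport.uRec β ≤ ℓ₂ →
      ∀ (q : Fin 4 × Fin 4) (x : Fin 4 → ℤ), q.1 < q.2 → ∀ η : LGConfig 4 (Matrix.specialUnitaryGroup (Fin 2) ℂ),
      (R : ℝ) ^ 4 / C₁ * |kerE (Matrix.specialUnitaryGroup (Fin 2) ℂ) (fundamentalLatticeRep 2) β (fun k => x k - (R + 1)) (2 * R + 3) η
          (plane (Matrix.specialUnitaryGroup (Fin 2) ℂ) (fundamentalLatticeRep 2) q x) -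
        kerE (Matrix.specialUnitaryGroup (Fin 2) ℂ) (fundamentalLatticeRep 2) β (fun k => x k - (R + 1)) (2 * R + 3) 1
          (plane (Matrix.specialUnitaryGroup (Fin 2) ℂ) (fundamentalLatticeRep 2) q x)| ≤
        A₂ + carrierCl (fundamentalLatticeRep 2) C_s 1 β R q x η)) : PureSplitClSU2 := by
  obtain ⟨C₁, A₁, P₀, β₁, ℓ₁, p, hC₁, hA₁, hℓ₁, hp, hDR⟩ := hDR
  obtain ⟨C_s, C₁', A₂, β₂, ℓ₂, hCs, hC₁', hA₂, hℓ₂, hCW⟩ := hCW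
  refine ⟨C_s * C₁ / C₁', C₁, A₁ + C₁' / C₁ * A₂, P₀, max β₁ β₂, min ℓ₁ ℓ₂, p, by positivity, hC₁, by positivity,
    lt_min hℓ₁ hℓ₂, hp, ?_⟩
  refine pureSplitCl_of_dirichletRate_and_coldWallSplit hC₁ ?_ ?_
  · intro β hβ R hR hRu q x hq
    exact hDR β ((le_max_left _ _).trans hβ) R hR (hRu.trans (min_le_left _ _)) q x hq
  · intro β hβ R hR hRu q x hq η
    have h0 := hCW β ((le_max_right _ _).trans hβ) R hR (hRu.trans (min_le_right _ _)) q x hq η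
    have hk : 0 ≤ C₁' / C₁ := by positivity
    have h1 := mul_le_mul_of_nonneg_left h0 hk
    have hlhs : C₁' / C₁ * ((R : ℝ) ^ 4 / C₁' *
        |kerE (Matrix.specialUnitaryGroup (Fin 2) ℂ) (fundamentalLatticeRep 2) β (fun k => x k - (R + 1)) (2 * R + 3) η
            (plane (Matrix.specialUnitaryGroup (Fin 2) ℂ) (fundamentalLatticeRep 2) q x) -
          kerE (Matrix.specialUnitaryGroup (Fin 2) ℂ) (fundamentalLatticeRep 2) β (fun k => x k - (R + 1)) (2 * R + 3) 1
            (plane (Matrix.specialUnitaryGroup (Fin 2) ℂ) (fundamentalLatticeRep 2) q x)|) =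
        (R : ℝ) ^ 4 / C₁ *
        |kerE (Matrix.specialUnitaryGroup (Fin 2) ℂ) (fundamentalLatticeRep 2) β (fun k => x k - (R + 1)) (2 * R + 3) η
            (plane (Matrix.specialUnitaryGroup (Fin 2) ℂ) (fundamentalLatticeRep 2) q x) -
          kerE (Matrix.specialUnitaryGroup (Fin 2) ℂ) (fundamentalLatticeRep 2) β (fun k => x k - (R + 1)) (2 * R + 3) 1
            (plane (Matrix.specialUnitaryGroup (Fin 2) ℂ) (fundamentalLatticeRep 2) q x)| := by
      field_simp
    have hrhs : C₁' / C₁ * (A₂ + carrierCl (fundamentalLatticeRep 2) C_s 1 β R q x η) =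
        C₁' / C₁ * A₂ + carrierCl (fundamentalLatticeRep 2) (C_s * C₁ / C₁') 1 β R q x η := by
      rw [carrierCl_eq_mul (fundamentalLatticeRep 2) C_s (C_s * C₁ / C₁') 1 β hCs.ne' R q x η]
      have : C_s / (C_s * C₁ / C₁') = C₁' / C₁ := by field_simp
      rw [this]; ring
    rw [hlhs, hrhs] at h1
    exact h1

/-- **(CW) ∧ (EM_Q^∃) ⇒ the flag-free split.** [folklore] -/
theorem pureSplitClSU2_of_coldWallSplit_of_carrierExpMoments (hCW : (∃ (C_s C₁ A₂ β₂ ℓ₂ : ℝ), 0 < C_s ∧ 0 < C₁ ∧ 0 ≤ A₂ ∧ 0 < ℓ₂ ∧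
      ∀ β : ℝ, β₂ ≤ β → ∀ R : ℕ, 1 ≤ R → (R : ℝ) * Transport.uRec β ≤ ℓ₂ →
      ∀ (q : Fin 4 × Fin 4) (x : Fin 4 → ℤ), q.1 < q.2 → ∀ η : LGConfig 4 (Matrix.specialUnitaryGroup (Fin 2) ℂ),
      (R : ℝ) ^ 4 / C₁ * |kerE (Matrix.specialUnitaryGroup (Fin 2) ℂ) (fundamentalLatticeRep 2) β (fun k => x k - (R + 1)) (2 * R + 3) η
          (plane (Matrix.specialUnitaryGroup (Fin 2) ℂ) (fundamentalLatticeRep 2) q x) -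
        kerE (Matrix.specialUnitaryGroup (Fin 2) ℂ) (fundamentalLatticeRep 2) β (fun k => x k - (R + 1)) (2 * R + 3) 1
          (plane (Matrix.specialUnitaryGroup (Fin 2) ℂ) (fundamentalLatticeRep 2) q x)| ≤
        A₂ + carrierCl (fundamentalLatticeRep 2) C_s 1 β R q x η)) (hCE : CarrierExpMomentsSU2) : PureSplitClSU2 :=
  pureSplitClSU2_of_dirichletRateSU2_of_coldWallSplit (dirichletRateSU2_of_coldWallSplit_of_carrierExpMoments hCW hCE) hCW

/-- **(CW) ∧ (EM_Q^∃) ⇒ the registered (RM) body `ResponseMomentsOdd6SU2`**: the measure side of «coldwall_pure» is (CW) and the binder (EM_Q^∃) —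
the sub-Gaussian LINEAR-source law (GD) is not needed as such. [folklore] -/
theorem responseMomentsOdd6SU2_of_coldWallSplit_of_carrierExpMoments (hCW : (∃ (C_s C₁ A₂ β₂ ℓ₂ : ℝ), 0 < C_s ∧ 0 < C₁ ∧ 0 ≤ A₂ ∧ 0 < ℓ₂ ∧
      ∀ β : ℝ, β₂ ≤ β → ∀ R : ℕ, 1 ≤ R → (R : ℝ) * Transport.uRec β ≤ ℓ₂ →
      ∀ (q : Fin 4 × Fin 4) (x : Fin 4 → ℤ), q.1 < q.2 → ∀ η : LGConfig 4 (Matrix.specialUnitaryGroup (Fin 2) ℂ),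
      (R : ℝ) ^ 4 / C₁ * |kerE (Matrix.specialUnitaryGroup (Fin 2) ℂ) (fundamentalLatticeRep 2) β (fun k => x k - (R + 1)) (2 * R + 3) η
          (plane (Matrix.specialUnitaryGroup (Fin 2) ℂ) (fundamentalLatticeRep 2) q x) -
        kerE (Matrix.specialUnitaryGroup (Fin 2) ℂ) (fundamentalLatticeRep 2) β (fun k => x k - (R + 1)) (2 * R + 3) 1
          (plane (Matrix.specialUnitaryGroup (Fin 2) ℂ) (fundamentalLatticeRep 2) q x)| ≤
        A₂ + carrierCl (fundamentalLatticeRep 2) C_s 1 β R q x η)) (hCE : CarrierExpMomentsSU2) :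
    ResponseMomentsOdd6SU2 :=
  responseMomentsOdd6SU2_of_pureSplitCl_and_carrierExpMoments (pureSplitClSU2_of_coldWallSplit_of_carrierExpMoments hCW hCE) hCE

end Summit.QuantumFields.YangMills.Cruxes.UVSeamRec.ClassicalResponse

end
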